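import Summits.CriticalPhenomena.PercolationContinuityZ3.Theorems.PercNearOneGluingNoHeavyLowerTailFourPointCutVertexGluing
import HarnessLib

/-!
# Four-point cells across a non-terminal cut vertex, II: the side dictionaries, the fifteen cells, and the split cut out by a vertex set

Support file for crux `stmt-CriticalPhenomena-4575` (master-family programme; Conjecture W = row `Q44` ∀n and every other four-point row),
seat `prim-l12-p6` gen 29; sequel of `…FourPointCutVertexGluing` (the cut-vertex gluing table `IsCutVertexSplit.cell_eq_sum`).
* `IsCutVertexSplit.of_side` — the cut-vertex split cut out by a vertex set `S ∋ a, b` with `c, y, v ∉ S` all of whose outgoing pairs of positive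
  weight end at the cut vertex `v` (`w₁` = restriction of `w` to the pairs meeting `S`, `w₂` = restriction to the pairs missing `S`);
* `IsCutVertexSplit.real_side1_eq` / `real_side2_eq` — THE SIDE DICTIONARIES: under `w₁` (resp. `w₂`) every pattern event of the five marked points
  `pent a b c y v` has measure `Σ_i [Φ (side1 i)] μ_{w₁}(atom pent (side1 i))` (resp. `Σ_j [Φ (side2 j)] μ_{w₂}(atom pent (side2 j))`) — the tool that
  turns three-point theorems for `(a,b,v)` under `w₁` and for `(v,c,y)` under `w₂` (SK3, Harris) into inequalities between the side laws;
* `IsCutVertexSplit.cell0 … cell14` — THE STRUCTURE LEMMA AT A CUT VERTEX: each four-point cell of `w` as an explicit bilinear form in the side laws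
  `P i = μ_{w₁}(atom pent (side1 i))` (`i = 0..4`: `a|b|v, ab|v, av|b, a|bv, abv`) and `Q j = μ_{w₂}(atom pent (side2 j))` (`v|c|y, vc|y, vy|c, v|cy, vcy`):
  `c₀ = P₀Q₀+P₀Q₁+P₀Q₂+P₂Q₀+P₃Q₀`, `c₁ = P₀Q₃+P₀Q₄+P₂Q₃+P₃Q₃`, `c₂ = P₃Q₂`, `c₃ = P₃Q₁`, `c₄ = P₂Q₂`, `c₅ = P₂Q₁`, `c₆ = P₁Q₀+P₁Q₁+P₁Q₂+P₄Q₀`,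
  `c₇ = P₃Q₄`, `c₈ = c₉ = 0`, `c₁₀ = P₂Q₄`, `c₁₁ = P₁Q₃+P₁Q₄+P₄Q₃`, `c₁₂ = P₄Q₂`, `c₁₃ = P₄Q₁`, `c₁₄ = P₄Q₄`.
Consumer: `…Q44CutVertex` (THEOREM D).  No definitions, no named facts, no sorries, standard axioms.
[cite: Grimmett1999, §2.2 (independence of disjoint edge sets)]
-/

noncomputable section

namespace Summit.CriticalPhenomena.PercolationContinuityZ3.Theorems

namespace FourPointCutVertex

open MeasureTheory Set Literature.Probability.LatticeModels Literature.Probability.Percolation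
open FourPointAtoms
open Summit.CriticalPhenomena.PercolationContinuityZ3.Cruxes.AdditiveGluing.TieLine.ConnAtoms
open scoped Classical

variable {n : ℕ}

namespace IsCutVertexSplit

/-! ## The split cut out by a vertex set -/

/-- **The cut-vertex split cut out by a vertex set.**  If `S ∋ a, b` avoids `c, y, v` and every pair of positive weight leaving `S` ends at `v`,
then `w` splits at the cut vertex `v` into its restriction `w₁` to the pairs meeting `S` (the piece of `a, b`) and its restriction `w₂` to the
pairs missing `S`. [this work] -/
theorem of_side (w : Sym2 (Fin n) → unitInterval) (a b c y v : Fin n) (S : Finset (Fin n)) (haS : a ∈ S) (hbS : b ∈ S) (hcS : c ∉ S)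
    (hyS : y ∉ S) (hvS : v ∉ S) (hS : ∀ u ∈ S, ∀ x, x ∉ S → x ≠ v → w s(u, x) = 0)
    (hab : a ≠ b) (hcy : c ≠ y) (hcv : c ≠ v) (hyv : y ≠ v) (w₁ w₂ : Sym2 (Fin n) → unitInterval)
    (hw₁ : ∀ e, w₁ e = if (∃ u ∈ S, u ∈ e) then w e else 0) (hw₂ : ∀ e, w₂ e = if (∃ u ∈ S, u ∈ e) then 0 else w e) :
    IsCutVertexSplit (Finset.univ.filter fun e => (∃ u ∈ S, u ∈ e) ∧ w e ≠ 0) (Finset.univ.filter fun e => ∀ u ∈ S, u ∉ e)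
      w w₁ w₂ a b c y v := by
  -- a pair of positive weight with a vertex in `S` and a vertex `x ∉ S` has `x = v`
  have key : ∀ e : Sym2 (Fin n), (∃ u ∈ S, u ∈ e) → w e ≠ 0 → ∀ x ∈ e, x ∉ S → x = v := by
    intro e hex hwe x hx hxS
    obtain ⟨u, huS, hue⟩ := hex
    have hux : u ≠ x := fun h' => hxS (h' ▸ huS)
    have he : e = s(u, x) := by
      induction e using Sym2.ind with
      | _ p q =>
        rcases Sym2.mem_iff.1 hue with rfl | rfl <;> rcases Sym2.mem_iff.1 hx with h' | h'
        · exact absurd h'.symm hux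
        · rw [h']
        · rw [h']; exact Sym2.eq_swap
        · exact absurd h'.symm hux
    by_contra hxv
    rw [he] at hwe
    exact hwe (hS u huS x hxS hxv)
  exact {
    disjoint := by
      rw [Finset.disjoint_left]
      intro e h1 h2
      rw [Finset.mem_filter] at h1 h2
      obtain ⟨u, huS, hue⟩ := h1.2.1
      exact h2.2 u huS hue
    cut := by
      intro u e₁ he₁ e₂ he₂ hu₁ hu₂
      rw [Finset.mem_filter] at he₁ he₂
      exact key e₁ he₁.2.1 he₁.2.2 u hu₁ (fun huS => he₂.2 u huS hu₂)
    zero := by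
      intro e h1 h2
      rw [Finset.mem_filter, not_and_or] at h1 h2
      rcases h2 with h2 | h2
      · exact absurd (Finset.mem_univ e) h2
      rcases h1 with h1 | h1
      · exact absurd (Finset.mem_univ e) h1
      push Not at h1 h2
      obtain ⟨u, huS, hue⟩ := h2
      exact h1 ⟨u, huS, hue⟩
    left := by
      intro e he
      rw [Finset.mem_filter] at he
      rw [hw₁, if_pos he.2.1]
    left_zero := by
      intro e he
      rw [Finset.mem_filter, not_and_or] at he
      rw [hw₁]
      split_ifs with hex
      · rcases he with he | he
        · exact absurd (Finset.mem_univ e) he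
        · by_contra hne
          exact he ⟨hex, hne⟩
      · rfl
    right := by
      intro e he
      rw [Finset.mem_filter] at he
      rw [hw₂, if_neg (by push Not; exact he.2)]
    right_zero := by
      intro e he
      rw [Finset.mem_filter, not_and_or] at he
      rw [hw₂]
      split_ifs with hex
      · rfl
      · rcases he with he | he
        · exact absurd (Finset.mem_univ e) he
        · push Not at he hex
          obtain ⟨u, huS, hue⟩ := he
          exact absurd hue (hex u huS)
    c_left := by
      intro e he hce
      rw [Finset.mem_filter] at he
      exact hcv (key e he.2.1 he.2.2 c hce hcS)
    y_left := by
      intro e he hye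
      rw [Finset.mem_filter] at he
      exact hyv (key e he.2.1 he.2.2 y hye hyS)
    a_right := by
      intro e he
      rw [Finset.mem_filter] at he
      exact he.2 a haS
    b_right := by
      intro e he
      rw [Finset.mem_filter] at he
      exact he.2 b hbS
    ne_ab := hab
    ne_ac := fun h' => hcS (h' ▸ haS)
    ne_ay := fun h' => hyS (h' ▸ haS)
    ne_av := fun h' => hvS (h' ▸ haS)
    ne_bc := fun h' => hcS (h' ▸ hbS)
    ne_by := fun h' => hyS (h' ▸ hbS)
    ne_bv := fun h' => hvS (h' ▸ hbS)
    ne_cy := hcy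
    ne_cv := hcv
    ne_yv := hyv }

variable {D₁ D₂ : Finset (Sym2 (Fin n))} {w w₁ w₂ : Sym2 (Fin n) → unitInterval} {a b c y v : Fin n}

/-! ## The side dictionaries -/

/-- **Side-one dictionary**: under `w₁` every pattern event of the five marked points has measure `Σ_i [Φ (side1 i)] μ_{w₁}(atom pent (side1 i))`. [this work] -/
theorem real_side1_eq (h : IsCutVertexSplit D₁ D₂ w w₁ w₂ a b c y v) {E : Set (BondConfig (Fin n))} {Φ : (Fin 5 → Fin 5) → Prop}
    [DecidablePred Φ] (hE : HasPattern (pent a b c y v) E Φ) :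
    (prodBernoulli w₁).real E = ∑ i : Fin 5, if Φ (side1 i) then (prodBernoulli w₁).real (atom (pent a b c y v) (side1 i)) else 0 := by
  classical
  have hae := prodBernoulli_ae_forall_notMem w₁ (Z := (↑D₁ : Set (Sym2 (Fin n)))ᶜ) (Set.to_countable _)
    (fun e he => h.left_zero e (fun h' => he (Finset.mem_coe.2 h')))
  have hcongr : (E : Set (BondConfig (Fin n))) =ᵐ[prodBernoulli w₁]
      (⋃ i ∈ (Finset.univ.filter fun i : Fin 5 => Φ (side1 i)), atom (pent a b c y v) (side1 i) : Set (BondConfig (Fin n))) := by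
    filter_upwards [hae] with ω hω
    have hωD : ω ∩ ↑D₁ = ω := Set.inter_eq_left.2 fun e he => by
      by_contra h'
      exact hω e h' he
    obtain ⟨i₀, hi₀⟩ := h.exists_side1 ω
    rw [hωD] at hi₀
    show (ω ∈ E) = (ω ∈ ⋃ i ∈ (Finset.univ.filter fun i : Fin 5 => Φ (side1 i)), atom (pent a b c y v) (side1 i))
    refine propext ⟨fun h' => ?_, fun h' => ?_⟩
    · exact Set.mem_iUnion₂.2 ⟨i₀, Finset.mem_filter.2 ⟨Finset.mem_univ _, (hE (isCanon_side1 i₀) hi₀).1 h'⟩, hi₀⟩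
    · obtain ⟨i, hi, hωi⟩ := Set.mem_iUnion₂.1 h'
      exact (hE (isCanon_side1 i) hωi).2 (Finset.mem_filter.1 hi).2
  rw [measureReal_congr hcongr, measureReal_biUnion_finset ?_ (fun _ _ => MeasurableSet.of_discrete), Finset.sum_filter]
  intro i _ i' _ hne
  exact disjoint_atom _ (isCanon_side1 i) (isCanon_side1 i') fun h' => hne (side1_injective h')

/-- **Side-two dictionary**: under `w₂` every pattern event of the five marked points has measure `Σ_j [Φ (side2 j)] μ_{w₂}(atom pent (side2 j))`. [this work] -/
theorem real_side2_eq (h : IsCutVertexSplit D₁ D₂ w w₁ w₂ a b c y v) {E : Set (BondConfig (Fin n))} {Φ : (Fin 5 → Fin 5) → Prop}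
    [DecidablePred Φ] (hE : HasPattern (pent a b c y v) E Φ) :
    (prodBernoulli w₂).real E = ∑ j : Fin 5, if Φ (side2 j) then (prodBernoulli w₂).real (atom (pent a b c y v) (side2 j)) else 0 := by
  classical
  have hae := prodBernoulli_ae_forall_notMem w₂ (Z := (↑D₂ : Set (Sym2 (Fin n)))ᶜ) (Set.to_countable _)
    (fun e he => h.right_zero e (fun h' => he (Finset.mem_coe.2 h')))
  have hcongr : (E : Set (BondConfig (Fin n))) =ᵐ[prodBernoulli w₂]
      (⋃ j ∈ (Finset.univ.filter fun j : Fin 5 => Φ (side2 j)), atom (pent a b c y v) (side2 j) : Set (BondConfig (Fin n))) := by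
    filter_upwards [hae] with ω hω
    have hωD : ω ∩ ↑D₂ = ω := Set.inter_eq_left.2 fun e he => by
      by_contra h'
      exact hω e h' he
    obtain ⟨j₀, hj₀⟩ := h.exists_side2 ω
    rw [hωD] at hj₀
    show (ω ∈ E) = (ω ∈ ⋃ j ∈ (Finset.univ.filter fun j : Fin 5 => Φ (side2 j)), atom (pent a b c y v) (side2 j))
    refine propext ⟨fun h' => ?_, fun h' => ?_⟩
    · exact Set.mem_iUnion₂.2 ⟨j₀, Finset.mem_filter.2 ⟨Finset.mem_univ _, (hE (isCanon_side2 j₀) hj₀).1 h'⟩, hj₀⟩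
    · obtain ⟨j, hj, hωj⟩ := Set.mem_iUnion₂.1 h'
      exact (hE (isCanon_side2 j) hωj).2 (Finset.mem_filter.1 hj).2
  rw [measureReal_congr hcongr, measureReal_biUnion_finset ?_ (fun _ _ => MeasurableSet.of_discrete), Finset.sum_filter]
  intro j _ j' _ hne
  exact disjoint_atom _ (isCanon_side2 j) (isCanon_side2 j') fun h' => hne (side2_injective h')

/-- `{x ↔ z}` for marked points `x = pent s`, `z = pent t` has pattern `π s = π t`. [folklore] -/
theorem oc5 (a b c y v : Fin n) (s t : Fin 5) {x z : Fin n} (hx : pent a b c y v s = x) (hz : pent a b c y v t = z) :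
    HasPattern (pent a b c y v) (openConn x z) fun π => π s = π t :=
  HasPattern.openConn_of_eq hx hz

/-! ## The structure lemma: the fifteen cells as bilinear forms in the two side laws -/

-- BEGIN STRUCTURE LEMMAS (generated)
/-- Cell `0` (`a|b|c|y`) of the glued weighting as a bilinear form in the law of `(a,b,v)` in the piece of `a, b` and the law of `(v,c,y)`
in the piece of `c, y` (the cut-vertex STRUCTURE LEMMA, entry `0`). [this work] -/
theorem cell0 (h : IsCutVertexSplit D₁ D₂ w w₁ w₂ a b c y v) :
    cell w a b c y 0 = (prodBernoulli w₁).real (atom (pent a b c y v) (side1 0)) * (prodBernoulli w₂).real (atom (pent a b c y v) (side2 0)) + (prodBernoulli w₁).real (atom (pent a b c y v) (side1 0)) * (prodBernoulli w₂).real (atom (pent a b c y v) (side2 1)) + (prodBernoulli w₁).real (atom (pent a b c y v) (side1 0)) * (prodBernoulli w₂).real (atom (pent a b c y v) (side2 2)) + (prodBernoulli w₁).real (atom (pent a b c y v) (side1 2)) * (prodBernoulli w₂).real (atom (pent a b c y v) (side2 0)) + (prodBernoulli w₁).real (atom (pent a b c y v) (side1 3)) * (prodBernoulli w₂).real (atom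 (pent a b c y v) (side2 0)) := by
  have H := h.cell_eq_sum 0
  simp (config := {decide := true}) [Fin.sum_univ_five] at H
  linarith [H]

/-- Cell `1` (`a|b|cy`) of the glued weighting as a bilinear form in the law of `(a,b,v)` in the piece of `a, b` and the law of `(v,c,y)`
in the piece of `c, y` (the cut-vertex STRUCTURE LEMMA, entry `1`). [this work] -/
theorem cell1 (h : IsCutVertexSplit D₁ D₂ w w₁ w₂ a b c y v) :
    cell w a b c y 1 = (prodBernoulli w₁).real (atom (pent a b c y v) (side1 0)) * (prodBernoulli w₂).real (atom (pent a b c y v) (side2 3)) + (prodBernoulli w₁).real (atom (pent a b c y v) (side1 0)) * (prodBernoulli w₂).real (atom (pent a b c y v) (side2 4)) + (prodBernoulli w₁).real (atom (pent a b c y v) (side1 2)) * (prodBernoulli w₂).real (atom (pent a b c y v) (side2 3)) + (prodBernoulli w₁).real (atom (pent a b c y v) (side1 3)) * (prodBernoulli w₂).real (atom (pent a b c y v) (side2 3)) := by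
  have H := h.cell_eq_sum 1
  simp (config := {decide := true}) [Fin.sum_univ_five] at H
  linarith [H]

/-- Cell `2` (`a|by|c`) of the glued weighting as a bilinear form in the law of `(a,b,v)` in the piece of `a, b` and the law of `(v,c,y)`
in the piece of `c, y` (the cut-vertex STRUCTURE LEMMA, entry `2`). [this work] -/
theorem cell2 (h : IsCutVertexSplit D₁ D₂ w w₁ w₂ a b c y v) :
    cell w a b c y 2 = (prodBernoulli w₁).real (atom (pent a b c y v) (side1 3)) * (prodBernoulli w₂).real (atom (pent a b c y v) (side2 2)) := by
  have H := h.cell_eq_sum 2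
  simp (config := {decide := true}) [Fin.sum_univ_five] at H
  linarith [H]

/-- Cell `3` (`a|bc|y`) of the glued weighting as a bilinear form in the law of `(a,b,v)` in the piece of `a, b` and the law of `(v,c,y)`
in the piece of `c, y` (the cut-vertex STRUCTURE LEMMA, entry `3`). [this work] -/
theorem cell3 (h : IsCutVertexSplit D₁ D₂ w w₁ w₂ a b c y v) :
    cell w a b c y 3 = (prodBernoulli w₁).real (atom (pent a b c y v) (side1 3)) * (prodBernoulli w₂).real (atom (pent a b c y v) (side2 1)) := by
  have H := h.cell_eq_sum 3
  simp (config := {decide := true}) [Fin.sum_univ_five] at H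
  linarith [H]

/-- Cell `4` (`ay|b|c`) of the glued weighting as a bilinear form in the law of `(a,b,v)` in the piece of `a, b` and the law of `(v,c,y)`
in the piece of `c, y` (the cut-vertex STRUCTURE LEMMA, entry `4`). [this work] -/
theorem cell4 (h : IsCutVertexSplit D₁ D₂ w w₁ w₂ a b c y v) :
    cell w a b c y 4 = (prodBernoulli w₁).real (atom (pent a b c y v) (side1 2)) * (prodBernoulli w₂).real (atom (pent a b c y v) (side2 2)) := by
  have H := h.cell_eq_sum 4
  simp (config := {decide := true}) [Fin.sum_univ_five] at H
  linarith [H]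

/-- Cell `5` (`ac|b|y`) of the glued weighting as a bilinear form in the law of `(a,b,v)` in the piece of `a, b` and the law of `(v,c,y)`
in the piece of `c, y` (the cut-vertex STRUCTURE LEMMA, entry `5`). [this work] -/
theorem cell5 (h : IsCutVertexSplit D₁ D₂ w w₁ w₂ a b c y v) :
    cell w a b c y 5 = (prodBernoulli w₁).real (atom (pent a b c y v) (side1 2)) * (prodBernoulli w₂).real (atom (pent a b c y v) (side2 1)) := by
  have H := h.cell_eq_sum 5
  simp (config := {decide := true}) [Fin.sum_univ_five] at H
  linarith [H]

/-- Cell `6` (`ab|c|y`) of the glued weighting as a bilinear form in the law of `(a,b,v)` in the piece of `a, b` and the law of `(v,c,y)`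
in the piece of `c, y` (the cut-vertex STRUCTURE LEMMA, entry `6`). [this work] -/
theorem cell6 (h : IsCutVertexSplit D₁ D₂ w w₁ w₂ a b c y v) :
    cell w a b c y 6 = (prodBernoulli w₁).real (atom (pent a b c y v) (side1 1)) * (prodBernoulli w₂).real (atom (pent a b c y v) (side2 0)) + (prodBernoulli w₁).real (atom (pent a b c y v) (side1 1)) * (prodBernoulli w₂).real (atom (pent a b c y v) (side2 1)) + (prodBernoulli w₁).real (atom (pent a b c y v) (side1 1)) * (prodBernoulli w₂).real (atom (pent a b c y v) (side2 2)) + (prodBernoulli w₁).real (atom (pent a b c y v) (side1 4)) * (prodBernoulli w₂).real (atom (pent a b c y v) (side2 0)) := by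
  have H := h.cell_eq_sum 6
  simp (config := {decide := true}) [Fin.sum_univ_five] at H
  linarith [H]

/-- Cell `7` (`a|bcy`) of the glued weighting as a bilinear form in the law of `(a,b,v)` in the piece of `a, b` and the law of `(v,c,y)`
in the piece of `c, y` (the cut-vertex STRUCTURE LEMMA, entry `7`). [this work] -/
theorem cell7 (h : IsCutVertexSplit D₁ D₂ w w₁ w₂ a b c y v) :
    cell w a b c y 7 = (prodBernoulli w₁).real (atom (pent a b c y v) (side1 3)) * (prodBernoulli w₂).real (atom (pent a b c y v) (side2 4)) := by
  have H := h.cell_eq_sum 7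
  simp (config := {decide := true}) [Fin.sum_univ_five] at H
  linarith [H]

/-- Cell `8` (`ay|bc`) of the glued weighting as a bilinear form in the law of `(a,b,v)` in the piece of `a, b` and the law of `(v,c,y)`
in the piece of `c, y` (the cut-vertex STRUCTURE LEMMA, entry `8`). [this work] -/
theorem cell8 (h : IsCutVertexSplit D₁ D₂ w w₁ w₂ a b c y v) :
    cell w a b c y 8 = 0 := by
  have H := h.cell_eq_sum 8
  simp (config := {decide := true}) [Fin.sum_univ_five] at H
  linarith [H]

/-- Cell `9` (`ac|by`) of the glued weighting as a bilinear form in the law of `(a,b,v)` in the piece of `a, b` and the law of `(v,c,y)`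
in the piece of `c, y` (the cut-vertex STRUCTURE LEMMA, entry `9`). [this work] -/
theorem cell9 (h : IsCutVertexSplit D₁ D₂ w w₁ w₂ a b c y v) :
    cell w a b c y 9 = 0 := by
  have H := h.cell_eq_sum 9
  simp (config := {decide := true}) [Fin.sum_univ_five] at H
  linarith [H]

/-- Cell `10` (`acy|b`) of the glued weighting as a bilinear form in the law of `(a,b,v)` in the piece of `a, b` and the law of `(v,c,y)`
in the piece of `c, y` (the cut-vertex STRUCTURE LEMMA, entry `10`). [this work] -/
theorem cell10 (h : IsCutVertexSplit D₁ D₂ w w₁ w₂ a b c y v) :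
    cell w a b c y 10 = (prodBernoulli w₁).real (atom (pent a b c y v) (side1 2)) * (prodBernoulli w₂).real (atom (pent a b c y v) (side2 4)) := by
  have H := h.cell_eq_sum 10
  simp (config := {decide := true}) [Fin.sum_univ_five] at H
  linarith [H]

/-- Cell `11` (`ab|cy`) of the glued weighting as a bilinear form in the law of `(a,b,v)` in the piece of `a, b` and the law of `(v,c,y)`
in the piece of `c, y` (the cut-vertex STRUCTURE LEMMA, entry `11`). [this work] -/
theorem cell11 (h : IsCutVertexSplit D₁ D₂ w w₁ w₂ a b c y v) :
    cell w a b c y 11 = (prodBernoulli w₁).real (atom (pent a b c y v) (side1 1)) * (prodBernoulli w₂).real (atom (pent a b c y v) (side2 3)) + (prodBernoulli w₁).real (atom (pent a b c y v) (side1 1)) * (prodBernoulli w₂).real (atom (pent a b c y v) (side2 4)) + (prodBernoulli w₁).real (atom (pent a b c y v) (side1 4)) * (prodBernoulli w₂).real (atom (pent a b c y v) (side2 3)) := by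
  have H := h.cell_eq_sum 11
  simp (config := {decide := true}) [Fin.sum_univ_five] at H
  linarith [H]

/-- Cell `12` (`aby|c`) of the glued weighting as a bilinear form in the law of `(a,b,v)` in the piece of `a, b` and the law of `(v,c,y)`
in the piece of `c, y` (the cut-vertex STRUCTURE LEMMA, entry `12`). [this work] -/
theorem cell12 (h : IsCutVertexSplit D₁ D₂ w w₁ w₂ a b c y v) :
    cell w a b c y 12 = (prodBernoulli w₁).real (atom (pent a b c y v) (side1 4)) * (prodBernoulli w₂).real (atom (pent a b c y v) (side2 2)) := by
  have H := h.cell_eq_sum 12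
  simp (config := {decide := true}) [Fin.sum_univ_five] at H
  linarith [H]

/-- Cell `13` (`abc|y`) of the glued weighting as a bilinear form in the law of `(a,b,v)` in the piece of `a, b` and the law of `(v,c,y)`
in the piece of `c, y` (the cut-vertex STRUCTURE LEMMA, entry `13`). [this work] -/
theorem cell13 (h : IsCutVertexSplit D₁ D₂ w w₁ w₂ a b c y v) :
    cell w a b c y 13 = (prodBernoulli w₁).real (atom (pent a b c y v) (side1 4)) * (prodBernoulli w₂).real (atom (pent a b c y v) (side2 1)) := by
  have H := h.cell_eq_sum 13
  simp (config := {decide := true}) [Fin.sum_univ_five] at H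
  linarith [H]

/-- Cell `14` (`abcy`) of the glued weighting as a bilinear form in the law of `(a,b,v)` in the piece of `a, b` and the law of `(v,c,y)`
in the piece of `c, y` (the cut-vertex STRUCTURE LEMMA, entry `14`). [this work] -/
theorem cell14 (h : IsCutVertexSplit D₁ D₂ w w₁ w₂ a b c y v) :
    cell w a b c y 14 = (prodBernoulli w₁).real (atom (pent a b c y v) (side1 4)) * (prodBernoulli w₂).real (atom (pent a b c y v) (side2 4)) := by
  have H := h.cell_eq_sum 14
  simp (config := {decide := true}) [Fin.sum_univ_five] at H
  linarith [H]
-- END STRUCTURE LEMMAS (generated)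

end IsCutVertexSplit

end FourPointCutVertex

end Summit.CriticalPhenomena.PercolationContinuityZ3.Theorems
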